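import Summits.ValiantsHypothesis.ValiantsHypothesis.Theorems.LacunarySymmetroidMatrixDescartesCensusResidual
import Summits.ValiantsHypothesis.ValiantsHypothesis.Theorems.LacunarySymmetroidMatrixDescartesCensusLogSqTransfer

/-!
# `MatrixDescartes` — master form of the night's route-design data: residual pencils, infinitely often, sizes `2^(O(log² K))`

CONDITIONAL: proves no part of MatrixDescartes; the hypothesis of `valiant_of_residual_logSq_io` is OPEN and implies
VH by this theorem, hence ≥ summit-hard; it is the conjunction of the weakenings recorded tonight, in ONE statement.

HONEST FRAMING.  Object-search cell `pub-symmetroid`, crux `Theses.LacunarySymmetroid.MatrixDescartes`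
(ledger item `stmt-ValiantsHypothesis-18050`, route `LacunarySymmetroid`; seat `val-sym-mdr-p1`; sector inputs of seat
`val-sym-mdr-p2` CITED: `mildlyLacunary_mdr`, `lowRankSector_eventually`, `oneAlternation_realRoots`,
`linearCount_absorbed`).  `ValiantsHypothesis` (`VP ≠ VNP` over `ℂ`) follows if, for every `c` and every `K₁`, there
is SOME `K ≥ K₁` (infinitely often, `…CensusRatioCloses`/`…CensusLogSqTransfer`) such that every `K`-term real symmetric
`m × m` lacunary pencil `(d, S)` which is
* in the window `K^(2t+1) < (12(m+K))^(t+1)` (`…CensusRatioWindow`) and of size `m ≤ 2^(c·(⌊log₂K⌋+1)²)`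
  (quadratic exponent, `…CensusLogSqTransfer`),
* genuinely lacunary: some `d l > 2^((⌊log₂K⌋+c+2)^(c+2))`,
* non-commuting, of coefficient span `≥ 3`, with at least two letters of rank `≥ 2^s`, and not a two-way
  one-alternation word (`…CensusResidual`),
satisfies `Z^(t+1) ≤ 2^(t·K⌊log₂K⌋)` — a saving of the constant factor `t/(t+1)` against the witness rate.  Every
excluded pencil satisfies the inequality by a kernel theorem; nothing is asserted about the residual ones.  Nothing
here bears on `DoorA26` / `DoorA34` or any census numeral; no new `Prop`.

[folklore] Case analysis over the companion files.
-/

-- `Summit.ValiantsHypothesis.ValiantsHypothesis.…` repeats a component by the D-0017 layout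
-- (single-conjunct summit), which the `dupNamespace` linter flags; the name is mandated.
set_option linter.dupNamespace false

namespace Summit.ValiantsHypothesis.ValiantsHypothesis.Theorems.LacunarySymmetroidMatrixDescartes.Census

open scoped BigOperators
open Polynomial

/-- **Master form.**  See the module docstring.  For `t ≥ 1` and any `s`: the residual ratio bound, infinitely often in
`K`, at sizes `≤ 2^(c·(⌊log₂K⌋+1)²)`, implies `VP ≠ VNP` over `ℂ`.  CONDITIONAL; the hypothesis is OPEN and ≥ summit-hard.
[folklore] -/
theorem valiant_of_residual_logSq_io (t s : ℕ) (ht : 0 < t)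
    (h : ∀ c K₁ : ℕ, ∃ K : ℕ, K₁ ≤ K ∧ ∀ m : ℕ, K ^ (2 * t + 1) < (12 * (m + K)) ^ (t + 1) →
      m ≤ 2 ^ (c * (Nat.log 2 K + 1) ^ 2) →
      ∀ (d : Fin K → ℕ) (S : Fin K → Matrix (Fin m) (Fin m) ℝ), (∀ l, (S l).IsSymm) →
        (∃ l, 2 ^ ((Nat.log 2 K + (c + 2)) ^ (c + 2)) < d l) →
        (¬ ∀ l l', S l * S l' = S l' * S l) →
        (¬ ∃ (A B : Matrix (Fin m) (Fin m) ℝ) (α β : Fin K → ℝ), ∀ l, S l = α l • A + β l • B) →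
        (∀ l₀ : Fin K, ∃ l, l ≠ l₀ ∧ 2 ^ s ≤ (S l).rank) →
        (¬ ∃ e e' : ℕ, (∀ l, d l < e → (S l).PosSemidef) ∧ (∀ l, e < d l → (-S l).PosSemidef) ∧
            (∀ l, d l < e' → (((-1 : ℝ) ^ d l) • S l).PosSemidef) ∧
            (∀ l, e' < d l → (-(((-1 : ℝ) ^ d l) • S l)).PosSemidef)) →
        (Matrix.det (∑ l, ((Polynomial.X : Polynomial ℝ) ^ d l) • (S l).map Polynomial.C)).roots.toFinset.card
            ^ (t + 1) ≤ 2 ^ (t * (K * Nat.log 2 K))) :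
    _root_.ValiantsHypothesis := by
  refine valiant_of_matrixDescartesRatio_logSq_io (t + 1) t (Nat.lt_succ_self t) fun c K₁ => ?_
  -- sector thresholds, stated in the crux's regime with exponent `c + 2 ⊇` the quadratic regime
  obtain ⟨K₂, hK₂⟩ := mildlyLacunary_mdr (c + 2) (t + 1)
  obtain ⟨K₃, hK₃⟩ := matrixDescartes_commutingSector (c + 2) (t + 1)
  obtain ⟨K₄, hK₄⟩ := matrixDescartes_spanTwoSector (c + 2) (t + 1)
  obtain ⟨K₅, hK₅⟩ := linearCount_absorbed (c + 2) (t + 1)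
  obtain ⟨P, hP⟩ : ∃ P : ℕ, P = 2 ^ ((t + 1) * s) := ⟨_, rfl⟩
  obtain ⟨K, hK₁, hK⟩ := h c (K₁ + K₂ + K₃ + K₄ + K₅ + P + 1)
  refine ⟨K, by omega, fun m hm d S hS => ?_⟩
  have hK0 : 0 < K := by omega
  have hK2 : K₂ ≤ K := by omega
  have hK3 : K₃ ≤ K := by omega
  have hK4 : K₄ ≤ K := by omega
  have hK5 : K₅ ≤ K := by omega
  have hK6 : 2 ^ ((t + 1) * s) ≤ K := by rw [← hP]; omega
  -- the quadratic-exponent size is inside the crux's regime with exponent `c + 2`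
  have hm' : m ≤ 2 ^ ((Nat.log 2 K + (c + 2)) ^ (c + 2)) :=
    hm.trans (Nat.pow_le_pow_right (by norm_num) (logSq_le_polylog c (Nat.log 2 K)))
  -- (0) below the window: Descartes sector of the ratio form
  rcases le_or_gt ((12 * (m + K)) ^ (t + 1)) (K ^ (2 * t + 1)) with hle | hwin
  · have e : 2 * t + 1 = (t + 1) + t := by ring
    rw [e] at hle
    exact matrixDescartesRatio_subpowerSector (t + 1) t K m (Nat.le_succ t) hK0 hle d S hS
  -- (1) mildly lacunary
  by_cases hlac : ∃ l, 2 ^ ((Nat.log 2 K + (c + 2)) ^ (c + 2)) < d l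
  swap
  · push Not at hlac
    exact ratio_of_unit ht (hK₂ K m hK2 hm' d S hlac)
  -- (2) commuting
  by_cases hcomm : ∀ l l', S l * S l' = S l' * S l
  · exact ratio_of_unit ht (hK₃ K m hK3 hm' d S hS hcomm)
  -- (3) span ≤ 2
  by_cases hspan : ∃ (A B : Matrix (Fin m) (Fin m) ℝ) (α β : Fin K → ℝ), ∀ l, S l = α l • A + β l • B
  · obtain ⟨A, B, α, β, hAB⟩ := hspan
    have e : S = fun l => α l • A + β l • B := funext hAB
    subst e
    exact ratio_of_unit ht (hK₄ K m hK4 hm' d A B α β)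
  -- (4) at most one fat letter
  by_cases hfat : ∀ l₀ : Fin K, ∃ l, l ≠ l₀ ∧ 2 ^ s ≤ (S l).rank
  swap
  · push Not at hfat
    obtain ⟨l₀, hl₀⟩ := hfat
    exact ratio_of_unit ht (lowRankSector_eventually (t + 1) s K m hK6 l₀ d S hl₀)
  -- (5) two-way one-alternation
  by_cases halt : ∃ e e' : ℕ, (∀ l, d l < e → (S l).PosSemidef) ∧ (∀ l, e < d l → (-S l).PosSemidef) ∧
      (∀ l, d l < e' → (((-1 : ℝ) ^ d l) • S l).PosSemidef) ∧
      (∀ l, e' < d l → (-(((-1 : ℝ) ^ d l) • S l)).PosSemidef)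
  · obtain ⟨e, e', hlo, hhi, hlo', hhi'⟩ := halt
    exact ratio_of_unit ht (hK₅ K m _ hK5 hm' (oneAlternation_realRoots K m e e' d S hS hlo hhi hlo' hhi'))
  -- (6) residual: the hypothesis
  exact hK m hwin hm d S hS hlac hcomm hspan hfat halt

end Summit.ValiantsHypothesis.ValiantsHypothesis.Theorems.LacunarySymmetroidMatrixDescartes.Census
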